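import Summits.CriticalPhenomena.PercolationContinuityZ3.Theorems.PercNearOneGluingNoHeavyLowerTailThreePointProductFormFibreCutVertex
import Summits.CriticalPhenomena.PercolationContinuityZ3.Theorems.PercNearOneGluingNoHeavyLowerTailThreePointProductFormFibreAdjacent
import HarnessLib

/-!
# The product form `#bad² ≤ #P1·#P2` in the fibre language: the PENDANT-APEX REDUCTION
# (Sahi programme, prover prim-sahi-p2 gen 54)

Support file (`--supports stmt-CriticalPhenomena-4575`, helper); continues `…ThreePointProductFormFibreCutVertex`.  Standard axioms, no sorries,
no named facts, no definitions.  Memo `run/shared/lean/prim/prim-sahi/FROM-prim-sahi-p2-gen53-PRODUCT-FORM.md` ('pendant apex: (H, a pendant at h)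
reduces exactly to (H − a, h)') and gen 54 memo §8.

SETTING.  A finite multigraph `(V, α, ends)` whose apex `a` is PENDANT at `h ≠ a`: every label meeting `a` has endpoints `{a, h}`.  The reduced
multigraph `H'` is written on the SAME label type: `ends' l = s(h, h)` (a loop, invisible to `openGraph`) if `a ∈ ends l`, else `ends l`; its apex
is `h`.  With `R z x y` = open connection in `(ends, z)`, `R' z x y` = open connection in `(ends', z)`, `♭z = clusterFlip ends a z̄`,
`♭'z = clusterFlip ends' h z̄`, `O z = (some label at a is open)`:
* `adj_of_adj'`, `adj'_of_adj`, `reachable_of_reachable'` — `H'` is `H` with the labels at `a` made loops: same adjacency away from `a`, `a` isolated.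
* **`reachable'_of_reachable`** [this work] — for `u, w ≠ a`: `R z u w → R' z u w` (a connection through the pendant vertex returns through `h`;
  closed-set argument, no path surgery); **`reachable_apex_iff`** — for `v ≠ a`: `R z a v ↔ O z ∧ R' z h v`.
* `flat_eq_flat'` [this work] — if `O z`, the flats `♭z` and `♭'z` agree on every label not at `a`; `reachable'_iff_of_agree_off` — `R'` only sees
  labels not at `a`.
* **`bad_iff_pendant`, `sa_iff_pendant`** [this work] — `bad_H(z) ↔ O z ∧ bad_{H'}(z)`, `P1_H(z) ↔ O z ∧ P1_{H'}(z)` (and the mirror for `P2`)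
  for terminals `s, c ≠ a` (apex of `H'` is `h`).
* **`productForm_of_pendant`** [this work] — THE REDUCTION: `(P)` for `(ends', h; s, c)` implies `(P)` for `(ends, a; s, c)`; by the independence
  count `card_and_mul_card_univ` (`O` lives on the labels at `a`, the `H'`-events on the others) the three cardinalities of `H` are those of `H'`
  times `#O / 2^{#labels at a}`.
[folklore] (pendant vertices do not carry connections between other vertices); [cite: Gladkov2024, Conjecture 10.1 (p. 18), arXiv:2408.08457] for (P).
-/

namespace Summit.CriticalPhenomena.PercolationContinuityZ3.Theorems.ProductFormFibre

open Finset Literature.Probability.Percolation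
open Summit.CriticalPhenomena.PercolationContinuityZ3.Theorems.ThreePointCPIClusterSwap
  (QTouch clusterFlip clusterFlip_of_qtouch clusterFlip_of_not_qtouch)

variable {V α : Type*}

section Pendant

variable [DecidableEq V] (ends : α → Sym2 V) (a h : V)

/-! ### 1. The reduced multigraph (labels at `a` become loops at `h`) -/

/-- An edge of the reduced multigraph is an edge of `H` carried by a label not at `a`; in particular it avoids `a`. [this work] -/
theorem adj_of_adj' (z : α → Bool) {u w : V}
    (hadj : (openGraph (labelledOpen (fun l => if a ∈ ends l then s(h, h) else ends l) z)).Adj u w) :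
    (openGraph (labelledOpen ends z)).Adj u w ∧ u ≠ a ∧ w ≠ a := by
  rw [openGraph_adj] at hadj
  obtain ⟨⟨l, hl, hle⟩, huw⟩ := hadj
  by_cases hal : a ∈ ends l
  · simp only [hal, if_true] at hle
    exfalso; apply huw
    have h1 : u ∈ (s(h, h) : Sym2 V) := by rw [hle]; exact Sym2.mem_mk_left u w
    have h2 : w ∈ (s(h, h) : Sym2 V) := by rw [hle]; exact Sym2.mem_mk_right u w
    rw [Sym2.mem_iff, or_self] at h1 h2
    rw [h1, h2]
  · simp only [hal, if_false] at hle
    refine ⟨?_, fun hu => hal ?_, fun hw => hal ?_⟩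
    · rw [openGraph_adj]; exact ⟨⟨l, hl, hle⟩, huw⟩
    · rw [hle, hu]; exact Sym2.mem_mk_left a w
    · rw [hle, hw]; exact Sym2.mem_mk_right u a

/-- Conversely an edge of `H` between vertices other than `a` is an edge of the reduced multigraph. [this work] -/
theorem adj'_of_adj (z : α → Bool) {u w : V} (hu : u ≠ a) (hw : w ≠ a)
    (hadj : (openGraph (labelledOpen ends z)).Adj u w) :
    (openGraph (labelledOpen (fun l => if a ∈ ends l then s(h, h) else ends l) z)).Adj u w := by
  rw [openGraph_adj] at hadj ⊢
  obtain ⟨⟨l, hl, hle⟩, huw⟩ := hadj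
  have hal : a ∉ ends l := by
    rw [hle, Sym2.mem_iff]; rintro (h1 | h1)
    · exact hu h1.symm
    · exact hw h1.symm
  exact ⟨⟨l, hl, by simp only [hal, if_false]; exact hle⟩, huw⟩

/-- Connections of the reduced multigraph are connections of `H`. [this work] -/
theorem reachable_of_reachable' (z : α → Bool) {u w : V}
    (hr : (openGraph (labelledOpen (fun l => if a ∈ ends l then s(h, h) else ends l) z)).Reachable u w) :
    (openGraph (labelledOpen ends z)).Reachable u w := by
  refine hr.mono ?_
  intro x y hxy
  exact (adj_of_adj' ends a h z hxy).1

omit [DecidableEq V] in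
/-- In `H`, a neighbour of the pendant apex is `h`, reached through an open label at `a`. [this work] -/
theorem eq_of_adj_apex (hpend : ∀ l, a ∈ ends l → ends l = s(a, h)) (z : α → Bool) {w : V}
    (hadj : (openGraph (labelledOpen ends z)).Adj a w) : w = h ∧ ∃ l, z l = true ∧ a ∈ ends l := by
  rw [openGraph_adj] at hadj
  obtain ⟨⟨l, hl, hle⟩, haw⟩ := hadj
  have hal : a ∈ ends l := by rw [hle]; exact Sym2.mem_mk_left a w
  have := hpend l hal
  rw [hle, Sym2.eq_iff] at this
  rcases this with ⟨-, h2⟩ | ⟨-, h2⟩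
  · exact ⟨h2, l, hl, hal⟩
  · exact absurd h2.symm haw

/-- **Connections away from the pendant apex survive in the reduced multigraph**: for `u, w ≠ a`, `R z u w → R' z u w`.  Closed-set argument:
the set `{v : R' u v} ∪ {a, if R' u h}` contains `u` and is closed under `H`-adjacency. [this work] -/
theorem reachable'_of_reachable (hha : h ≠ a) (hpend : ∀ l, a ∈ ends l → ends l = s(a, h)) (z : α → Bool) {u w : V}
    (hu : u ≠ a) (hw : w ≠ a) (hr : (openGraph (labelledOpen ends z)).Reachable u w) :
    (openGraph (labelledOpen (fun l => if a ∈ ends l then s(h, h) else ends l) z)).Reachable u w := by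
  set G' := openGraph (labelledOpen (fun l => if a ∈ ends l then s(h, h) else ends l) z) with hG'
  have key : w ∈ {v : V | (v ≠ a ∧ G'.Reachable u v) ∨ (v = a ∧ G'.Reachable u h)} := by
    refine TransplantRecipes.mem_of_reachable (G := openGraph (labelledOpen ends z))
      (S := {v : V | (v ≠ a ∧ G'.Reachable u v) ∨ (v = a ∧ G'.Reachable u h)})
      (Or.inl ⟨hu, SimpleGraph.Reachable.refl u⟩) ?_ hr
    rintro v x (⟨hva, hv⟩ | ⟨rfl, hv⟩) hadj
    · by_cases hxa : x = a
      · subst hxa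
        have := (eq_of_adj_apex ends x h hpend z hadj.symm).1
        subst this
        exact Or.inr ⟨rfl, hv⟩
      · exact Or.inl ⟨hxa, hv.trans (adj'_of_adj ends a h z hva hxa hadj).reachable⟩
    · have hx := (eq_of_adj_apex ends v h hpend z hadj).1
      subst hx
      exact Or.inl ⟨hha, hv⟩
  rcases key with ⟨-, h1⟩ | ⟨h1, -⟩
  · exact h1
  · exact absurd h1 hw

/-- For `u, w ≠ a`: `R z u w ↔ R' z u w`. [this work] -/
theorem reachable_iff_reachable' (hha : h ≠ a) (hpend : ∀ l, a ∈ ends l → ends l = s(a, h)) (z : α → Bool) {u w : V}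
    (hu : u ≠ a) (hw : w ≠ a) :
    (openGraph (labelledOpen ends z)).Reachable u w ↔
      (openGraph (labelledOpen (fun l => if a ∈ ends l then s(h, h) else ends l) z)).Reachable u w :=
  ⟨reachable'_of_reachable ends a h hha hpend z hu hw, reachable_of_reachable' ends a h z⟩

/-- **Connections from the pendant apex**: for `v ≠ a`, `R z a v ↔ (some label at a is open) ∧ R' z h v`. [this work] -/
theorem reachable_apex_iff (hha : h ≠ a) (hpend : ∀ l, a ∈ ends l → ends l = s(a, h)) (z : α → Bool) {v : V} (hv : v ≠ a) :
    (openGraph (labelledOpen ends z)).Reachable a v ↔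
      (∃ l, z l = true ∧ a ∈ ends l) ∧
        (openGraph (labelledOpen (fun l => if a ∈ ends l then s(h, h) else ends l) z)).Reachable h v := by
  constructor
  · rintro ⟨p⟩
    cases p with
    | nil => exact absurd rfl hv
    | cons hadj p =>
      obtain ⟨hw, hO⟩ := eq_of_adj_apex ends a h hpend z hadj
      subst hw
      exact ⟨hO, reachable'_of_reachable ends a _ hha hpend z hha hv ⟨p⟩⟩
  · rintro ⟨⟨l, hl, hal⟩, hr⟩
    have hadj : (openGraph (labelledOpen ends z)).Adj a h := by
      rw [openGraph_adj]; exact ⟨⟨l, hl, hpend l hal⟩, hha.symm⟩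
    exact hadj.reachable.trans (reachable_of_reachable' ends a h z hr)

/-- The reduced multigraph only sees the labels not at `a`: configurations agreeing off `a` have the same `R'`. [this work] -/
theorem reachable'_of_agree_off {z z' : α → Bool} (hagree : ∀ l, a ∉ ends l → z l = true → z' l = true) {u w : V}
    (hr : (openGraph (labelledOpen (fun l => if a ∈ ends l then s(h, h) else ends l) z)).Reachable u w) :
    (openGraph (labelledOpen (fun l => if a ∈ ends l then s(h, h) else ends l) z')).Reachable u w := by
  obtain ⟨p⟩ := hr
  refine reachable_of_walk_of_labels _ z z' p fun l hl he => hagree l ?_ hl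
  intro hal
  have heG := p.edges_subset_edgeSet he
  rw [openGraph, SimpleGraph.edgeSet_fromEdgeSet] at heG
  apply heG.2
  show Sym2.IsDiag ((fun l => if a ∈ ends l then s(h, h) else ends l) l)
  simp only [hal, if_true]
  exact Sym2.mk_isDiag_iff.mpr rfl

/-- Symmetric form of `reachable'_of_agree_off`. [this work] -/
theorem reachable'_iff_of_agree_off {z z' : α → Bool} (hagree : ∀ l, a ∉ ends l → z l = z' l) (u w : V) :
    (openGraph (labelledOpen (fun l => if a ∈ ends l then s(h, h) else ends l) z)).Reachable u w ↔
      (openGraph (labelledOpen (fun l => if a ∈ ends l then s(h, h) else ends l) z')).Reachable u w :=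
  ⟨reachable'_of_agree_off ends a h (fun l hl hz => (hagree l hl) ▸ hz),
   reachable'_of_agree_off ends a h (fun l hl hz => (hagree l hl).symm ▸ hz)⟩

/-! ### 2. The two flats agree off `a` -/

/-- **If some label at `a` is open, the flat of `H` (apex `a`) and the flat of `H'` (apex `h`) agree on every label not at `a`.** [this work] -/
theorem flat_eq_flat' (hha : h ≠ a) (hpend : ∀ l, a ∈ ends l → ends l = s(a, h)) (z : α → Bool)
    (hO : ∃ l, z l = true ∧ a ∈ ends l) {l : α} (hal : a ∉ ends l) :
    clusterFlip ends a (fun x => !z x) l =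
      clusterFlip (fun l => if a ∈ ends l then s(h, h) else ends l) h (fun x => !z x) l := by
  classical
  have hq : QTouch ends a (fun x => !z x) l ↔
      QTouch (fun l => if a ∈ ends l then s(h, h) else ends l) h (fun x => !z x) l := by
    rw [qtouch_compl_iff, qtouch_compl_iff]
    simp only [hal, if_false]
    constructor
    · rintro ⟨v, hv, hr⟩
      have hva : v ≠ a := fun h' => hal (h' ▸ hv)
      exact ⟨v, hv, ((reachable_apex_iff ends a h hha hpend z hva).1 hr).2⟩
    · rintro ⟨v, hv, hr⟩
      have hva : v ≠ a := fun h' => hal (h' ▸ hv)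
      exact ⟨v, hv, (reachable_apex_iff ends a h hha hpend z hva).2 ⟨hO, hr⟩⟩
  by_cases hq1 : QTouch ends a (fun x => !z x) l
  · rw [clusterFlip_of_qtouch ends a _ hq1, clusterFlip_of_qtouch _ h _ (hq.1 hq1)]
  · rw [clusterFlip_of_not_qtouch ends a _ hq1, clusterFlip_of_not_qtouch _ h _ (fun h' => hq1 (hq.2 h'))]

omit [DecidableEq V] in
/-- Without an open label at `a`, the flat of `H` agrees with `z` itself off `a`. [this work] -/
theorem flat_eq_self_of_not (hpend : ∀ l, a ∈ ends l → ends l = s(a, h)) (z : α → Bool)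
    (hO : ¬ ∃ l, z l = true ∧ a ∈ ends l) {l : α} (hal : a ∉ ends l) :
    clusterFlip ends a (fun x => !z x) l = z l := by
  classical
  have hq : ¬ QTouch ends a (fun x => !z x) l := by
    rw [qtouch_compl_iff]
    rintro ⟨v, hv, hr⟩
    have hva : v ≠ a := fun h' => hal (h' ▸ hv)
    obtain ⟨p⟩ := hr
    cases p with
    | nil => exact hva rfl
    | cons hadj p => exact hO (eq_of_adj_apex ends a h hpend z hadj).2
  rw [clusterFlip_of_not_qtouch ends a _ hq, Bool.not_not]

/-! ### 3. The three events of `H` are `O ∧` the events of `H'` -/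

/-- **`bad_H ↔ O ∧ bad_{H'}`** for terminals `s, c ≠ a`. [this work] -/
theorem bad_iff_pendant (hha : h ≠ a) (hpend : ∀ l, a ∈ ends l → ends l = s(a, h)) {s c : V} (hsa : s ≠ a) (hca : c ≠ a)
    (z : α → Bool) :
    ((¬ (openGraph (labelledOpen ends z)).Reachable a s ∧ ¬ (openGraph (labelledOpen ends z)).Reachable a c ∧
        ¬ (openGraph (labelledOpen ends z)).Reachable s c) ∧
      (openGraph (labelledOpen ends (clusterFlip ends a fun x => !z x))).Reachable s c) ↔
    ((∃ l, z l = true ∧ a ∈ ends l) ∧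
      ((¬ (openGraph (labelledOpen (fun l => if a ∈ ends l then s(h, h) else ends l) z)).Reachable h s ∧
          ¬ (openGraph (labelledOpen (fun l => if a ∈ ends l then s(h, h) else ends l) z)).Reachable h c ∧
          ¬ (openGraph (labelledOpen (fun l => if a ∈ ends l then s(h, h) else ends l) z)).Reachable s c) ∧
        (openGraph (labelledOpen (fun l => if a ∈ ends l then s(h, h) else ends l)
          (clusterFlip (fun l => if a ∈ ends l then s(h, h) else ends l) h fun x => !z x))).Reachable s c)) := by
  classical
  -- `s ↔ c` after the flats, given `O`
  have hflat : (∃ l, z l = true ∧ a ∈ ends l) →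
      ((openGraph (labelledOpen ends (clusterFlip ends a fun x => !z x))).Reachable s c ↔
        (openGraph (labelledOpen (fun l => if a ∈ ends l then s(h, h) else ends l)
          (clusterFlip (fun l => if a ∈ ends l then s(h, h) else ends l) h fun x => !z x))).Reachable s c) := by
    intro hO
    rw [reachable_iff_reachable' ends a h hha hpend _ hsa hca]
    exact reachable'_iff_of_agree_off ends a h (fun l hal => flat_eq_flat' ends a h hha hpend z hO hal) s c
  constructor
  · rintro ⟨⟨h1, h2, h3⟩, h4⟩
    -- some label at `a` must be open: otherwise the flat agrees with `z` off `a` and `s ↔ c` would hold in `z`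
    have hO : ∃ l, z l = true ∧ a ∈ ends l := by
      by_contra hO
      apply h3
      have h4' := (reachable_iff_reachable' ends a h hha hpend _ hsa hca).1 h4
      have h5 := (reachable'_iff_of_agree_off ends a h
        (fun l hal => flat_eq_self_of_not ends a h hpend z hO hal) s c).1 h4'
      exact reachable_of_reachable' ends a h z h5
    refine ⟨hO, ⟨fun h' => h1 ((reachable_apex_iff ends a h hha hpend z hsa).2 ⟨hO, h'⟩),
      fun h' => h2 ((reachable_apex_iff ends a h hha hpend z hca).2 ⟨hO, h'⟩),
      fun h' => h3 (reachable_of_reachable' ends a h z h')⟩, (hflat hO).1 h4⟩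
  · rintro ⟨hO, ⟨h1, h2, h3⟩, h4⟩
    refine ⟨⟨fun h' => h1 ((reachable_apex_iff ends a h hha hpend z hsa).1 h').2,
      fun h' => h2 ((reachable_apex_iff ends a h hha hpend z hca).1 h').2,
      fun h' => h3 (reachable'_of_reachable ends a h hha hpend z hsa hca h')⟩, (hflat hO).2 h4⟩

/-- **`{a ↔ s, a ↮ c} ↔ O ∧ {h ↔ s, h ↮ c in H'}`** for `s, c ≠ a` (used for `P1` and, with `s, c` exchanged, for `P2`). [this work] -/
theorem sa_iff_pendant (hha : h ≠ a) (hpend : ∀ l, a ∈ ends l → ends l = s(a, h)) {s c : V} (hsa : s ≠ a) (hca : c ≠ a)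
    (z : α → Bool) :
    ((openGraph (labelledOpen ends z)).Reachable a s ∧ ¬ (openGraph (labelledOpen ends z)).Reachable a c) ↔
    ((∃ l, z l = true ∧ a ∈ ends l) ∧
      ((openGraph (labelledOpen (fun l => if a ∈ ends l then s(h, h) else ends l) z)).Reachable h s ∧
        ¬ (openGraph (labelledOpen (fun l => if a ∈ ends l then s(h, h) else ends l) z)).Reachable h c)) := by
  rw [reachable_apex_iff ends a h hha hpend z hsa, reachable_apex_iff ends a h hha hpend z hca]
  constructor
  · rintro ⟨⟨hO, h1⟩, h2⟩
    exact ⟨hO, h1, fun h' => h2 ⟨hO, h'⟩⟩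
  · rintro ⟨hO, h1, h2⟩
    exact ⟨⟨hO, h1⟩, fun h' => h2 h'.2⟩

end Pendant

/-! ### 4. The reduction -/

section Reduction

variable [Fintype α] [DecidableEq α] [DecidableEq V]

open Classical in
/-- **THE PENDANT-APEX REDUCTION.**  If the apex `a` is pendant at `h ≠ a` (every label at `a` has endpoints `{a, h}`) and `s, c ≠ a`, then
CONJECTURE (P) for the reduced multigraph `ends'` (labels at `a` turned into loops at `h`) with apex `h` implies (P) for `(ends, a)`:
`#bad'² ≤ #P1'·#P2' → #bad² ≤ #P1·#P2`. [this work] -/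
theorem productForm_of_pendant (ends : α → Sym2 V) (a h s c : V) (hha : h ≠ a)
    (hpend : ∀ l, a ∈ ends l → ends l = s(a, h)) (hsa : s ≠ a) (hca : c ≠ a)
    (hP' :
      (univ.filter fun z : α → Bool =>
          (¬ (openGraph (labelledOpen (fun l => if a ∈ ends l then s(h, h) else ends l) z)).Reachable h s ∧
              ¬ (openGraph (labelledOpen (fun l => if a ∈ ends l then s(h, h) else ends l) z)).Reachable h c ∧
              ¬ (openGraph (labelledOpen (fun l => if a ∈ ends l then s(h, h) else ends l) z)).Reachable s c) ∧
            (openGraph (labelledOpen (fun l => if a ∈ ends l then s(h, h) else ends l)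
              (clusterFlip (fun l => if a ∈ ends l then s(h, h) else ends l) h fun x => !z x))).Reachable s c).card ^ 2 ≤
      (univ.filter fun z : α → Bool =>
          (openGraph (labelledOpen (fun l => if a ∈ ends l then s(h, h) else ends l) z)).Reachable h s ∧
            ¬ (openGraph (labelledOpen (fun l => if a ∈ ends l then s(h, h) else ends l) z)).Reachable h c).card *
      (univ.filter fun z : α → Bool =>
          (openGraph (labelledOpen (fun l => if a ∈ ends l then s(h, h) else ends l) z)).Reachable h c ∧
            ¬ (openGraph (labelledOpen (fun l => if a ∈ ends l then s(h, h) else ends l) z)).Reachable h s).card) :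
    (univ.filter fun z : α → Bool =>
        (¬ (openGraph (labelledOpen ends z)).Reachable a s ∧ ¬ (openGraph (labelledOpen ends z)).Reachable a c ∧
          ¬ (openGraph (labelledOpen ends z)).Reachable s c) ∧
        (openGraph (labelledOpen ends (clusterFlip ends a fun x => !z x))).Reachable s c).card ^ 2 ≤
    (univ.filter fun z : α → Bool =>
        (openGraph (labelledOpen ends z)).Reachable a s ∧ ¬ (openGraph (labelledOpen ends z)).Reachable a c).card *
    (univ.filter fun z : α → Bool =>
        (openGraph (labelledOpen ends z)).Reachable a c ∧ ¬ (openGraph (labelledOpen ends z)).Reachable a s).card := by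
  -- abbreviations for the reduced events
  set ends' : α → Sym2 V := fun l => if a ∈ ends l then s(h, h) else ends l with hends'
  let O : (α → Bool) → Prop := fun z => ∃ l, z l = true ∧ a ∈ ends l
  let B' : (α → Bool) → Prop := fun z =>
    (¬ (openGraph (labelledOpen ends' z)).Reachable h s ∧ ¬ (openGraph (labelledOpen ends' z)).Reachable h c ∧
        ¬ (openGraph (labelledOpen ends' z)).Reachable s c) ∧
      (openGraph (labelledOpen ends' (clusterFlip ends' h fun x => !z x))).Reachable s c
  let Q1' : (α → Bool) → Prop := fun z =>
    (openGraph (labelledOpen ends' z)).Reachable h s ∧ ¬ (openGraph (labelledOpen ends' z)).Reachable h c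
  let Q2' : (α → Bool) → Prop := fun z =>
    (openGraph (labelledOpen ends' z)).Reachable h c ∧ ¬ (openGraph (labelledOpen ends' z)).Reachable h s
  -- rewrite the three `H`-events as `O ∧ H'`-events
  have hbad : (univ.filter fun z : α → Bool =>
        (¬ (openGraph (labelledOpen ends z)).Reachable a s ∧ ¬ (openGraph (labelledOpen ends z)).Reachable a c ∧
          ¬ (openGraph (labelledOpen ends z)).Reachable s c) ∧
        (openGraph (labelledOpen ends (clusterFlip ends a fun x => !z x))).Reachable s c) =
      univ.filter fun z => O z ∧ B' z :=
    Finset.filter_congr fun z _ => bad_iff_pendant ends a h hha hpend hsa hca z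
  have hP1 : (univ.filter fun z : α → Bool =>
        (openGraph (labelledOpen ends z)).Reachable a s ∧ ¬ (openGraph (labelledOpen ends z)).Reachable a c) =
      univ.filter fun z => O z ∧ Q1' z :=
    Finset.filter_congr fun z _ => sa_iff_pendant ends a h hha hpend hsa hca z
  have hP2 : (univ.filter fun z : α → Bool =>
        (openGraph (labelledOpen ends z)).Reachable a c ∧ ¬ (openGraph (labelledOpen ends z)).Reachable a s) =
      univ.filter fun z => O z ∧ Q2' z :=
    Finset.filter_congr fun z _ => sa_iff_pendant ends a h hha hpend hca hsa z
  -- independence: `O` depends on the labels at `a`, the primed events on the others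
  have hOdep : ∀ z z' : α → Bool, (∀ l, a ∈ ends l → z l = z' l) → O z → O z' :=
    fun z z' hag ⟨l, hl, hal⟩ => ⟨l, (hag l hal) ▸ hl, hal⟩
  have hR' : ∀ z z' : α → Bool, (∀ l, ¬ a ∈ ends l → z l = z' l) → ∀ u w,
      ((openGraph (labelledOpen ends' z)).Reachable u w ↔ (openGraph (labelledOpen ends' z')).Reachable u w) :=
    fun z z' hag u w => reachable'_iff_of_agree_off ends a h hag u w
  have hF' : ∀ z z' : α → Bool, (∀ l, ¬ a ∈ ends l → z l = z' l) → ∀ u w,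
      ((openGraph (labelledOpen ends' (clusterFlip ends' h fun x => !z x))).Reachable u w ↔
        (openGraph (labelledOpen ends' (clusterFlip ends' h fun x => !z' x))).Reachable u w) := by
    intro z z' hag u w
    refine reachable'_iff_of_agree_off ends a h (fun l hal => ?_) u w
    -- the flat of `H'` at a label not at `a` is determined by the labels not at `a`
    have hq : QTouch ends' h (fun x => !z x) l ↔ QTouch ends' h (fun x => !z' x) l := by
      rw [qtouch_compl_iff, qtouch_compl_iff]
      constructor
      · rintro ⟨v, hv, hr⟩; exact ⟨v, hv, (hR' z z' hag h v).1 hr⟩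
      · rintro ⟨v, hv, hr⟩; exact ⟨v, hv, (hR' z z' hag h v).2 hr⟩
    by_cases hq1 : QTouch ends' h (fun x => !z x) l
    · rw [clusterFlip_of_qtouch ends' h _ hq1, clusterFlip_of_qtouch ends' h _ (hq.1 hq1)]
      simp only [hag l hal]
    · rw [clusterFlip_of_not_qtouch ends' h _ hq1, clusterFlip_of_not_qtouch ends' h _ (fun h' => hq1 (hq.2 h'))]
      simp only [Bool.not_not, hag l hal]
  have hB'dep : ∀ z z' : α → Bool, (∀ l, ¬ a ∈ ends l → z l = z' l) → B' z → B' z' := by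
    intro z z' hag hb
    simp only [B'] at hb ⊢
    rw [← hR' z z' hag h s, ← hR' z z' hag h c, ← hR' z z' hag s c, ← hF' z z' hag s c]
    exact hb
  have hQ1dep : ∀ z z' : α → Bool, (∀ l, ¬ a ∈ ends l → z l = z' l) → Q1' z → Q1' z' := by
    intro z z' hag hq; simp only [Q1'] at hq ⊢
    rw [← hR' z z' hag h s, ← hR' z z' hag h c]; exact hq
  have hQ2dep : ∀ z z' : α → Bool, (∀ l, ¬ a ∈ ends l → z l = z' l) → Q2' z → Q2' z' := by
    intro z z' hag hq; simp only [Q2'] at hq ⊢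
    rw [← hR' z z' hag h c, ← hR' z z' hag h s]; exact hq
  have hIbad := card_and_mul_card_univ (fun l => a ∈ ends l) O B' hOdep hB'dep
  have hIP1 := card_and_mul_card_univ (fun l => a ∈ ends l) O Q1' hOdep hQ1dep
  have hIP2 := card_and_mul_card_univ (fun l => a ∈ ends l) O Q2' hOdep hQ2dep
  rw [hbad, hP1, hP2]
  set U := (univ : Finset (α → Bool)).card with hU
  set NO := (univ.filter O).card
  set NB := (univ.filter fun z => O z ∧ B' z).card
  set N1 := (univ.filter fun z => O z ∧ Q1' z).card
  set N2 := (univ.filter fun z => O z ∧ Q2' z).card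
  set NB' := (univ.filter B').card
  set N1' := (univ.filter Q1').card
  set N2' := (univ.filter Q2').card
  have hP'' : NB' ^ 2 ≤ N1' * N2' := hP'
  have hUpos : 0 < U := Finset.card_pos.mpr Finset.univ_nonempty
  have key : NB ^ 2 * (U * U) ≤ N1 * N2 * (U * U) := by
    calc NB ^ 2 * (U * U) = (NB * U) * (NB * U) := by ring
      _ = (NO * NB') * (NO * NB') := by rw [hIbad]
      _ = (NO * NO) * NB' ^ 2 := by ring
      _ ≤ (NO * NO) * (N1' * N2') := Nat.mul_le_mul_left _ hP''
      _ = (NO * N1') * (NO * N2') := by ring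
      _ = (N1 * U) * (N2 * U) := by rw [hIP1, hIP2]
      _ = N1 * N2 * (U * U) := by ring
  exact Nat.le_of_mul_le_mul_right key (Nat.mul_pos hUpos hUpos)

end Reduction

end Summit.CriticalPhenomena.PercolationContinuityZ3.Theorems.ProductFormFibre
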